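import Summits.ResolutionOfSingularities.ResolutionOfSingularities.Theorems.HilbertSamuelEliminationSigmaMaxModificationsCorridor3WLadderIsoKernelPerfectNoetherian
import HarnessLib

/-!
# [OURS · L1 W4.2] KERNEL CENSUS SLICE: over a perfect ground field no isolated E3 point tower is shadowed by a subvariety `Z` carrying a
# NOETHERIAN valuation that follows the tower (composite valuations `v = v_Z ∘ v̄` with `v̄` discrete of rank one are EMPTY — curves, SURFACES, or
# `Z = X` itself)

Crux chain w42 (`SigmaMaxModifications`, stmt-ResolutionOfSingularities-18506; conjunct `SigmaMaxModificationsCorridor3`, stmt-…-19249),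
line `w_ladder`, registered stub `stub_isoSepRecurrent` of skeleton v8.8. Lead res-L1-w42-lead-1 (gen 6). Helper file
`--supports stmt-ResolutionOfSingularities-19249`; kernel only (no definition, no named fact).

WHAT IS PROVED.
* `eventually_not_satellite_of_shadow_noetherian` (subring level; the common core of `…CurveShadowChain` (i) and `…NoetherianValuation`): a dominating
  chain `B n` with principal `𝔪(B n)·B(n+1) = t_n B(n+1)`, read by compatible `φ n : B n → F` dominated by a NOETHERIAN valuation ring `W` of `F`,
  `φ 0 ≢ 0` on `𝔪(B 0)`: the principal ideals `φ(t_n)·W` increase, stabilise, and then `s_n` (`t_n = s_n t_{n+1}`) is a unit — finitely many satellite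
  steps. No dimension hypothesis on the shadow.
* `eventually_not_satellite_of_overring_noetherian` (overring form): readings `B n ≤ C → κ(C)` for a local overring `C` with some element of `𝔪(B 0)`
  a unit of `C`, and a Noetherian valuation ring `W` of `κ(C)` dominating the images.
* `false_of_isIsoPointTower_over_perfectField_of_shadow_noetherian` (scheme level): an isolated E3 point tower over a maximal origin, integral stages,
  origin stage separated / quasi-compact / locally of finite type over a PERFECT field of characteristic `p`, points `c n ∈ X_n` (`c (n+1) ↦ c n`,
  `c n ⤳ pt n`, the prime of `c 0` in `𝒪_{X_0,pt 0}` not maximal — `cl{c 0}` is a subvariety `Z` of ANY positive dimension through the points, e.g. a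
  SURFACE, or `X_0` itself when `c 0` is the generic point) and a NOETHERIAN valuation ring `W` of the residue field of
  `C = towerStalkEmb(𝒪_{X_0,c 0})` (= the function field of `Z`) dominating the images of the `𝒪_{X_n,pt n}` (the centres of `W` on the strict transforms
  `Z_n` are the `pt n`): IMPOSSIBLE — the tower is satellite-recurrent (res-L1-w42-stub-2 route A, `satelliteRecurrent_of_isIsoPointTower_over_perfectField`)
  and eventually non-satellite. Census reading: over perfect ground fields the composite valuations `v = v_Z ∘ v̄` with `v̄` DISCRETE of rank one
  (all «`ℤ^r`-lex flag» valuations, in particular surface-then-curve flags) never dominate a counterexample tower; with `…CurveShadow` (every `v̄` when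
  `Z` is a curve) and `…PerfectNoetherian` (`Z = X`), the open valuation classes are: rank one with dense value group, and surface-composite with
  NON-discrete `v̄`.

HONEST FRAMING. OURS plumbing; nothing here is a statement of H. Hironaka's manuscript [Hironaka2017] nor of [CossartJannsenSaito2020] /
[CossartPiltant2009]. AI-written; AI review is weaker than expert review.
References: O. Zariski, P. Samuel, *Commutative Algebra* II, Ch. VI §10 (composite valuations), App. 5 [ZariskiSamuel1960]; S. D. Cutkosky,
resolution notes §2.1–2.2 [Cutkosky2014]; V. Cossart, O. Piltant, J. Algebra 321 (2009), ch. 3 I.9 [CossartPiltant2009].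
-/

noncomputable section

set_option linter.dupNamespace false

open CategoryTheory AlgebraicGeometry TopologicalSpace IsLocalRing
open Summit.ResolutionOfSingularities.ResolutionOfSingularities.Theorems.CampaignW42
open Summit.ResolutionOfSingularities.ResolutionOfSingularities.Theorems.SigmaMaxModificationsCorridor3
open Literature.AlgebraicGeometry.Resolution Literature.AlgebraicGeometry.CossartJannsenSaito2020
open Summit.ResolutionOfSingularities.ResolutionOfSingularities.Cruxes.SigmaMaxModifications.IdeasL1Idea2R4
  (IsIsoPointTower IsoQuadraticTowerTerminates)

namespace Summit.ResolutionOfSingularities.ResolutionOfSingularities.Cruxes.SigmaMaxModifications.IdeasL1C5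

universe u

/-! ## §1. Subring level: readings dominated by a Noetherian valuation ring -/

section Subring

variable {L : Type u} [Field L] {F : Type u} [Field F] {B : ℕ → Subring L} [hloc : ∀ n, IsLocalRing (B n)]
  (hdom : ∀ n, SubringDominates (B n) (B (n + 1)))
  (φ : ∀ n, B n →+* F) (hφ : ∀ n (x : B n), φ (n + 1) (Subring.inclusion (hdom n).1 x) = φ n x)
  (W : ValuationSubring F) (hW : ∀ n (x : B n), φ n x ∈ W)
  (hWdom : ∀ n (x : B n), x ∈ maximalIdeal (B n) → W.valuation (φ n x) < 1)

include hφ hW hWdom in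
/-- **Readings dominated by a NOETHERIAN valuation ring: finitely many satellite steps.** The principal ideals `φ(t_n)·W` increase (`t_n = s_n t_{n+1}`)
and stabilise; `φ(t_n) W = φ(t_{n+1}) W` with `φ(t_{n+1}) ≠ 0` makes `φ(s_n)` a unit of `W`, so `s_n ∉ 𝔪(B(n+2))` (domination) is a unit and the step is
not satellite. [cite: ZariskiSamuel1960, App. 5] [cite: Cutkosky2014, §2.1] -/
theorem eventually_not_satellite_of_shadow_noetherian [IsNoetherianRing W]
    (hprin : ∀ n, ∃ t ∈ maximalIdeal (B n), ∀ x ∈ maximalIdeal (B n), ∃ y : B (n + 1), (x : L) = y * t)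
    (h0 : ∃ x ∈ maximalIdeal (B 0), φ 0 x ≠ 0) :
    ∃ n₀, ∀ n, n₀ ≤ n → ∃ t ∈ maximalIdeal (B n), ∀ x ∈ maximalIdeal (B (n + 1)), ∃ y : B (n + 2), (x : L) = y * t := by
  classical
  choose t ht hgen using hprin
  have htincl : ∀ n, Subring.inclusion (hdom n).1 (t n) ∈ maximalIdeal (B (n + 1)) :=
    fun n => inclusion_mem_maximalIdeal (hdom n) (ht n)
  have hs' : ∀ n, ∃ s : B (n + 2), (t n : L) = s * t (n + 1) := fun n => hgen (n + 1) _ (htincl n)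
  choose s hs using hs'
  have hle2 : ∀ n, B n ≤ B (n + 2) := fun n => le_of_le hdom (Nat.le_add_right n 2)
  have hincl2 : ∀ n, Subring.inclusion (hle2 n) (t n) = s n * Subring.inclusion (hdom (n + 1)).1 (t (n + 1)) :=
    fun n => Subtype.ext (hs n)
  have hread : ∀ n, φ n (t n) = φ (n + 2) (s n) * φ (n + 1) (t (n + 1)) := by
    intro n
    rw [← reading_inclusion hdom φ hφ (Nat.le_add_right n 2) (t n), hincl2, map_mul, hφ]
  -- the readings of the `t n` are nonzero
  obtain ⟨x₀, hx₀, hx₀0⟩ := h0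
  have hane : ∀ n, φ n (t n) ≠ 0 := by
    intro n hzero
    have hkill : ∀ x ∈ maximalIdeal (B n), φ n x = 0 := by
      intro x hx
      obtain ⟨y, hy⟩ := hgen n x hx
      have hxy : Subring.inclusion (hdom n).1 x = y * Subring.inclusion (hdom n).1 (t n) := Subtype.ext hy
      rw [← hφ n x, hxy, map_mul, hφ, hzero, mul_zero]
    refine hx₀0 ?_
    rw [← reading_inclusion hdom φ hφ (Nat.zero_le n) x₀]
    exact hkill _ (inclusion_mem_maximalIdeal (subringDominates_of_le hdom (Nat.zero_le n)) hx₀)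
  -- the increasing chain of principal ideals `φ(t n) W`
  let tW : ∀ n, W := fun n => ⟨φ n (t n), hW n _⟩
  let sW : ∀ n, W := fun n => ⟨φ (n + 2) (s n), hW _ _⟩
  have htW : ∀ n, tW n = sW n * tW (n + 1) := fun n => Subtype.ext (hread n)
  let J : ℕ →o Ideal W :=
    ⟨fun n => Ideal.span {tW n}, monotone_nat_of_le_succ fun n => by
      rw [Ideal.span_singleton_le_iff_mem, htW n]
      exact Ideal.mul_mem_left _ _ (Ideal.mem_span_singleton_self _)⟩
  obtain ⟨n₀, hn₀⟩ := monotone_stabilizes_iff_noetherian.mpr (inferInstance : IsNoetherianRing W) J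
  refine ⟨n₀, fun n hn => ⟨t n, ht n, fun x hx => ?_⟩⟩
  have hJ : Ideal.span {tW (n + 1)} = Ideal.span {tW n} := by
    have h1 := hn₀ (n + 1) (Nat.le_succ_of_le hn)
    have h2 := hn₀ n hn
    change Ideal.span {tW n₀} = Ideal.span {tW (n + 1)} at h1
    change Ideal.span {tW n₀} = Ideal.span {tW n} at h2
    rw [← h1, ← h2]
  obtain ⟨u, hu⟩ : ∃ u : W, u * tW n = tW (n + 1) := by
    have : tW (n + 1) ∈ Ideal.span {tW n} := by rw [← hJ]; exact Ideal.mem_span_singleton_self _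
    exact Ideal.mem_span_singleton'.mp this
  have hut : (u : F) * φ n (t n) = φ (n + 1) (t (n + 1)) := by
    have h := congrArg (fun z : W => (z : F)) hu
    simpa using h
  have hsu : (u : F) * φ (n + 2) (s n) = 1 := by
    have h' : ((u : F) * φ (n + 2) (s n)) * φ (n + 1) (t (n + 1)) = 1 * φ (n + 1) (t (n + 1)) := by
      rw [one_mul, mul_assoc, ← hread n, hut]
    exact mul_right_cancel₀ (hane (n + 1)) h'
  have hs1 : W.valuation (φ (n + 2) (s n)) = 1 := by
    have hle1 : W.valuation (φ (n + 2) (s n)) ≤ 1 := (W.valuation_le_one_iff _).mpr (hW _ _)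
    have hle2 : W.valuation (u : F) ≤ 1 := (W.valuation_le_one_iff _).mpr u.2
    have h1 : W.valuation (u : F) * W.valuation (φ (n + 2) (s n)) = 1 := by rw [← map_mul, hsu, map_one]
    by_contra hne
    have hlt : W.valuation (φ (n + 2) (s n)) < 1 := lt_of_le_of_ne hle1 hne
    have : W.valuation (u : F) * W.valuation (φ (n + 2) (s n)) < 1 * 1 :=
      mul_lt_mul_of_le_of_lt_of_nonneg_of_pos hle2 hlt zero_le zero_lt_one
    rw [h1, one_mul] at this
    exact lt_irrefl _ this
  have hsunit : IsUnit (s n) := by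
    by_contra hsu'
    have hlt := hWdom _ _ ((IsLocalRing.mem_maximalIdeal _).mpr hsu')
    rw [hs1] at hlt
    exact lt_irrefl _ hlt
  obtain ⟨w, hw⟩ := hsunit
  obtain ⟨y, hy⟩ := hgen (n + 1) x hx
  refine ⟨y * ↑w⁻¹, ?_⟩
  have hut' : (t (n + 1) : L) = ((↑w⁻¹ : B (n + 2)) : L) * t n := by
    rw [hs n, ← hw, ← mul_assoc, ← Subring.coe_mul, Units.inv_mul, Subring.coe_one, one_mul]
  rw [hy, hut', ← mul_assoc, Subring.coe_mul]

end Subring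

/-! ## §2. Overring form: readings in `κ(C)` for a local overring `C`, dominated by a Noetherian valuation ring of `κ(C)` -/

section Overring

variable {L : Type u} [Field L] {B : ℕ → Subring L} [hloc : ∀ n, IsLocalRing (B n)]
  (hdom : ∀ n, SubringDominates (B n) (B (n + 1)))
  (C : Subring L) [IsLocalRing C] (hBC : ∀ n, B n ≤ C)

include hdom in
/-- **Overring form.** Chain `B n` inside a local overring `C` (some element of `𝔪(B 0)` a unit of `C`), `W` a NOETHERIAN valuation ring of `κ(C)`
containing the residues of the `B n` and dominating them (`x ∈ 𝔪(B n) ⇒` residue of `x` in `𝔪_W`): finitely many satellite steps.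
[cite: ZariskiSamuel1960, App. 5] -/
theorem eventually_not_satellite_of_overring_noetherian
    (hprin : ∀ n, ∃ t ∈ maximalIdeal (B n), ∀ x ∈ maximalIdeal (B n), ∃ y : B (n + 1), (x : L) = y * t)
    (hsep : ∃ x ∈ maximalIdeal (B 0), Subring.inclusion (hBC 0) x ∉ maximalIdeal C)
    (W : ValuationSubring (ResidueField C)) [IsNoetherianRing W]
    (hW : ∀ n (x : B n), residue C (Subring.inclusion (hBC n) x) ∈ W)
    (hWdom : ∀ n (x : B n), x ∈ maximalIdeal (B n) → W.valuation (residue C (Subring.inclusion (hBC n) x)) < 1) :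
    ∃ n₀, ∀ n, n₀ ≤ n → ∃ t ∈ maximalIdeal (B n), ∀ x ∈ maximalIdeal (B (n + 1)), ∃ y : B (n + 2), (x : L) = y * t := by
  let φ : ∀ n, B n →+* ResidueField C := fun n => (residue C).comp (Subring.inclusion (hBC n))
  have hφ : ∀ n (x : B n), φ (n + 1) (Subring.inclusion (hdom n).1 x) = φ n x := fun n x => rfl
  have h0 : ∃ x ∈ maximalIdeal (B 0), φ 0 x ≠ 0 := by
    obtain ⟨x, hx, hxC⟩ := hsep
    exact ⟨x, hx, fun h => hxC ((residue_eq_zero_iff _).mp h)⟩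
  exact eventually_not_satellite_of_shadow_noetherian hdom φ hφ W hW hWdom hprin h0

end Overring

/-! ## §3. Scheme level: subvariety shadows carrying a Noetherian valuation, over a perfect ground field -/

section Scheme

variable {p : ℕ} {ν : ℕ → ℕ} {T : BlowupTower.{u}} {hint : ∀ n, IsIntegral (T.X n)} {pt : ∀ n, T.X n}

/-- **OVER A PERFECT GROUND FIELD NO ISOLATED E3 POINT TOWER IS SHADOWED BY A SUBVARIETY CARRYING A NOETHERIAN VALUATION THAT FOLLOWS IT.**
A generization `c₀ ⤳ pt 0` whose prime in `𝒪_{X_0,pt 0}` is not maximal (the closure `Z` of `c₀` is a subvariety of positive dimension — ANY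
dimension: curve, surface, or `X_0`), `C = towerStalkEmb(𝒪_{X_0,c₀})` (its local ring at the generic point, read in `K(X_0)`) CONTAINING the
canonical images of all the `𝒪_{X_n,pt n}` (i.e. every `pt n` lies on the strict transform `Z_n`), and `W` a NOETHERIAN valuation ring of `κ(C)` (the
function field of `Z`) containing and dominating the residues of those images (the centres of `W` on the `Z_n` are the `pt n`). Then `False`: satellite-recurrent
(res-L1-w42-stub-2 route A over a perfect field) versus eventually non-satellite. [cite: ZariskiSamuel1960, Ch. VI §10, App. 5] [cite: CossartPiltant2009, ch. 3 I.9] -/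
theorem false_of_isIsoPointTower_over_perfectField_of_shadow_noetherian
    {k : Type u} [Field k] [CharP k p] [PerfectField k] (f : T.X 0 ⟶ Spec (.of k)) [IsSeparated f] [LocallyOfFiniteType f] [QuasiCompact f]
    (hO : IsMaximalOrigin p 3 ν (T.X 0) (pt 0)) (hT : IsIsoPointTower 3 ν T pt)
    (c₀ : T.X 0) (hc₀ : c₀ ⤳ pt 0)
    (hP : (maximalIdeal ((T.X 0).presheaf.stalk c₀)).comap ((T.X 0).presheaf.stalkSpecializes hc₀).hom ≠
      maximalIdeal ((T.X 0).presheaf.stalk (pt 0)))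
    [hCloc : IsLocalRing (towerStalkEmb T hint 0 c₀).range]
    (hBC : ∀ n, (towerStalkEmb T hint n (pt n)).range ≤ (towerStalkEmb T hint 0 c₀).range)
    (W : ValuationSubring (ResidueField (towerStalkEmb T hint 0 c₀).range)) [IsNoetherianRing W]
    (hW : ∀ n (x : (towerStalkEmb T hint n (pt n)).range), residue _ (Subring.inclusion (hBC n) x) ∈ W)
    (hWdom : ∀ n (x : (towerStalkEmb T hint n (pt n)).range),
      ((x : (T.X 0).functionField) = 0 ∨ (x : (T.X 0).functionField)⁻¹ ∉ (towerStalkEmb T hint n (pt n)).range) →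
        W.valuation (residue _ (Subring.inclusion (hBC n) x)) < 1) : False := by
  haveI := hint
  haveI := fun n => T.ln n
  set Θ := towerStalkEmb T hint with hΘ
  haveI hB : ∀ n (y : T.X n), IsLocalRing (Θ n y).range := fun n y => isLocalRing_of_range_eq (Θ n y) _ rfl
  have hdom : ∀ n, SubringDominates (Θ n (pt n)).range (Θ (n + 1) (pt (n + 1))).range :=
    subringDominates_range_succ hT.2.1 (fun n => Θ n (pt n)) (fun n => towerStalkEmb_injective T hint n _)
      (towerStalkEmb_comp_stalkMap_pt T hint hT.2.1)
  obtain ⟨O', -, hQT⟩ := exists_dominatesTower T hint hT.1 hT.2.1 hT.2.2.1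
  have hprin : ∀ n, ∃ t ∈ maximalIdeal (Θ n (pt n)).range, ∀ x ∈ maximalIdeal (Θ n (pt n)).range,
      ∃ y : (Θ (n + 1) (pt (n + 1))).range, (x : (T.X 0).functionField) = y * t := by
    intro n
    obtain ⟨_, hLB⟩ := hQT n
    obtain ⟨u₀, hu₀, hgen⟩ := hLB.exists_span_singleton
    exact ⟨u₀, hu₀, fun x hx => by obtain ⟨y, hy, hxy⟩ := hgen x hx; exact ⟨⟨y, hy⟩, hxy⟩⟩
  -- `hsep` from `hP`, through the canonical embeddings
  have hmax : ∀ n (y : T.X n) (a : (T.X n).presheaf.stalk y),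
      a ∈ maximalIdeal _ ↔ (⟨Θ n y a, ⟨a, rfl⟩⟩ : (Θ n y).range) ∈ maximalIdeal (Θ n y).range :=
    fun n y a => mem_maximalIdeal_iff_range (Θ n y) (towerStalkEmb_injective T hint n y) a
  set sp := ((T.X 0).presheaf.stalkSpecializes hc₀).hom with hsp
  set P : Ideal ((T.X 0).presheaf.stalk (pt 0)) := (maximalIdeal ((T.X 0).presheaf.stalk c₀)).comap sp with hPdef
  have hspΘ : ∀ g, Θ 0 c₀ (sp g) = Θ 0 (pt 0) g := fun g => RingHom.congr_fun (towerStalkEmb_comp_stalkSpecializes T hint 0 hc₀) g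
  have hsep : ∃ x ∈ maximalIdeal (Θ 0 (pt 0)).range, Subring.inclusion (hBC 0) x ∉ maximalIdeal (Θ 0 c₀).range := by
    have hPle : P ≤ maximalIdeal _ := IsLocalRing.le_maximalIdeal (Ideal.IsPrime.ne_top (Ideal.comap_isPrime _ _))
    obtain ⟨g, hg, hgP⟩ := SetLike.exists_of_lt (lt_of_le_of_ne hPle hP)
    refine ⟨⟨Θ 0 (pt 0) g, ⟨g, rfl⟩⟩, (hmax 0 (pt 0) g).mp hg, fun h => hgP ?_⟩
    rw [hPdef, Ideal.mem_comap, hmax 0 c₀]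
    have heq : (⟨Θ 0 c₀ (sp g), ⟨sp g, rfl⟩⟩ : (Θ 0 c₀).range) = Subring.inclusion (hBC 0) ⟨Θ 0 (pt 0) g, ⟨g, rfl⟩⟩ :=
      Subtype.ext (hspΘ g)
    rw [heq]; exact h
  have hWdom' : ∀ n (x : (Θ n (pt n)).range), x ∈ maximalIdeal _ →
      W.valuation (residue _ (Subring.inclusion (hBC n) x)) < 1 :=
    fun n x hx => hWdom n x ((mem_maximalIdeal_iff_inv_not_mem x).mp hx)
  obtain ⟨n₀, hn₀⟩ := eventually_not_satellite_of_overring_noetherian hdom (Θ 0 c₀).range hBC hprin hsep W hW hWdom'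
  obtain ⟨n, hn, hsat⟩ := satelliteRecurrent_of_isIsoPointTower_over_perfectField f hO hT n₀
  exact not_isSatelliteStep_of_range_form hT.2.1 n (hn₀ n hn) hsat

end Scheme

end Summit.ResolutionOfSingularities.ResolutionOfSingularities.Cruxes.SigmaMaxModifications.IdeasL1C5

end
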